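import Mathlib

/-!
# One-Frobenius criteria at `3` (and the Borel discriminant criterion at any `p`) for the image
# conditions of route `SqrtFiveQuarticCovers` — kernel-checked `(trace, det)` bookkeeping

Route `Langlands/SqrtFiveQuarticCovers` (cell `pub/lg-quartmod`, F-L1).  The route's 3-clause
(`ReductionToRefinedLocus`, `RefinedLocusModular`, `BoxBorelFive`) is: for some framing, the mod-3
image `G = ρ̄_{E,3}(Γ_K) ≤ GL₂(𝔽₃)` is Borel (`(ρ̄ σ)₁₀ = 0` for all `σ`) or lies in the split
Cartan normaliser `C_s⁺(3) = ⟨diag(1,2), antidiag(1,1)⟩`; its 7-clause is "Borel or inside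
`G(e7)`".  The cell's per-point verdict ledger (E11) decides these from Frobenius data
`(a_𝔓 mod p, N𝔓 mod p) = (trace, det)` of `ρ̄(Frob_𝔓)`.  This file is the kernel-checked group
theory behind the criteria AT 3, plus the prime-independent Borel criterion (companion of
`SqrtFiveQuarticCoversTraceDetTables` at 5 and `…TablesSeven` at 7):

* `trace_sq_sub_four_det_of_apply_one_zero` / `isSquare_disc_of_conj_borel` /
  `not_conj_borel_of_witness` (any commutative ring `R`): a subgroup of `GL₂(R)` conjugate into
  the upper-triangular Borel has `trace² − 4·det` a square at every element; ONE element with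
  non-square `trace² − 4·det` (irreducible characteristic polynomial) excludes Borel.
* at `3`: in the Borel AND in `C_s⁺(3)` (which is the full monomial group of `GL₂(𝔽₃)`,
  `mem_monomial_of_mem_Cs3`) every element of determinant `2 = -1` has trace `0`
  (`trace_eq_zero_of_borel3`, `trace_eq_zero_of_mem_Cs3`); hence the kill-lemma
  `not_borel_or_conj_Cs3_of_witness`: ONE `g ∈ G` with `det g = 2`, `trace g ≠ 0`
  (`N𝔓 ≡ 2 (mod 3)`, `a_𝔓 ≢ 0 (mod 3)`) makes `G` "large at 3" — the route's 3-clause fails for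
  every framing; and `not_conj_borel3_of_witness_det_one` (`det 1`, `trace 0` excludes Borel alone);
* (§3, appended) the same in discriminant form, as used by the cell's flags `W3b`/`W3s`:
  `isSquare_disc_of_mem_Cs3`, `not_conj_Cs3_of_witness_disc`, `not_borel_or_conj_Cs3_of_witness_disc`.

Finite group theory only (`decide` over at most three elements of `ZMod 3`); no definitions;
standard axioms; imports only Mathlib.  Nothing here is a statement about elliptic curves: the
dictionary `(N𝔓, a_𝔓) ↦ (det, trace)` of `ρ̄(Frob_𝔓)` is the user's standard input.
References: [FreitasLeHungSiksek2015] Prop. 1.1(a) (the group `C_s⁺(3)`); [Box2022] Thm 1.3.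
-/

set_option linter.dupNamespace false -- project-wide option (lakefile weak.linter.dupNamespace); `Summit.Langlands.Langlands` is the mandated namespace

namespace Summit.Langlands.Langlands.Theorems.SqrtFiveQuarticCovers

open Matrix

/-! ## 1. The Borel discriminant criterion (any commutative ring) -/

/-- For an upper-triangular `2 × 2` matrix, `trace² − 4·det = (M₀₀ − M₁₁)²`. [folklore] -/
theorem trace_sq_sub_four_det_of_apply_one_zero {R : Type*} [CommRing R]
    (M : Matrix (Fin 2) (Fin 2) R) (h : M 1 0 = 0) :
    Matrix.trace M ^ 2 - 4 * M.det = (M 0 0 - M 1 1) ^ 2 := by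
  rw [Matrix.trace_fin_two, Matrix.det_fin_two, h]
  ring

/-- **Borel ⇒ square discriminants.** If `G ≤ GL₂(R)` is conjugate into the upper-triangular Borel
subgroup, then `trace(g)² − 4·det(g)` is a square for every `g ∈ G`. [folklore] -/
theorem isSquare_disc_of_conj_borel {R : Type*} [CommRing R] {G : Subgroup (GL (Fin 2) R)}
    (h : ∃ x : GL (Fin 2) R, ∀ g ∈ G, ((x * g * x⁻¹ : GL (Fin 2) R) : Matrix (Fin 2) (Fin 2) R) 1 0 = 0) :
    ∀ g ∈ G, IsSquare (Matrix.trace (g : Matrix (Fin 2) (Fin 2) R) ^ 2 -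
      4 * Matrix.det (g : Matrix (Fin 2) (Fin 2) R)) := by
  intro g hg
  obtain ⟨x, hx⟩ := h
  have key := trace_sq_sub_four_det_of_apply_one_zero _ (hx g hg)
  rw [Units.val_mul, Units.val_mul, Matrix.trace_units_conj, Matrix.det_units_conj] at key
  exact ⟨_, by rw [key, sq]⟩

/-- **Kill-lemma against Borel (any `p`).** A subgroup containing an element whose
`trace² − 4·det` is not a square (irreducible characteristic polynomial) is not conjugate into the
Borel subgroup.  For `ρ̄_{E,p}`: one good prime with `a_𝔓² − 4·N𝔓` a non-square mod `p`.
[folklore] -/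
theorem not_conj_borel_of_witness {R : Type*} [CommRing R] {G : Subgroup (GL (Fin 2) R)}
    {g : GL (Fin 2) R} (hg : g ∈ G)
    (hns : ¬ IsSquare (Matrix.trace (g : Matrix (Fin 2) (Fin 2) R) ^ 2 -
      4 * Matrix.det (g : Matrix (Fin 2) (Fin 2) R))) :
    ¬ ∃ x : GL (Fin 2) R, ∀ g ∈ G, ((x * g * x⁻¹ : GL (Fin 2) R) : Matrix (Fin 2) (Fin 2) R) 1 0 = 0 :=
  fun h => hns (isSquare_disc_of_conj_borel h g hg)

/-! ## 2. At `3`: Borel and `C_s⁺(3)` -/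

/-- Every `2 × 2` matrix over `ZMod 3` is `!![a, b; c, d]`. [folklore] -/
theorem exists_eq_fin_two_zmod3 (m : Matrix (Fin 2) (Fin 2) (ZMod 3)) :
    ∃ a b c d : ZMod 3, m = !![a, b; c, d] :=
  ⟨m 0 0, m 0 1, m 1 0, m 1 1, Matrix.eta_fin_two m⟩

/-- **Borel at 3, determinant `2` ⇒ trace `0`** (the diagonal is `{1, 2}`). [folklore] -/
theorem trace_eq_zero_of_borel3 (M : Matrix (Fin 2) (Fin 2) (ZMod 3)) (h : M 1 0 = 0)
    (hd : M.det = 2) : M.trace = 0 := by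
  obtain ⟨a, b, c, d, rfl⟩ := exists_eq_fin_two_zmod3 M
  rw [Matrix.det_fin_two_of] at hd
  rw [Matrix.trace_fin_two_of]
  simp only [Matrix.of_apply, Matrix.cons_val', Matrix.cons_val_zero, Matrix.cons_val_one,
    Matrix.cons_val_fin_one, Matrix.empty_val'] at h
  subst h
  revert a b d hd; decide

/-- **Borel at 3, determinant `1` ⇒ trace `≠ 0`** (the diagonal is `{a, a}`, trace `2a`).
[folklore] -/
theorem trace_ne_zero_of_borel3 (M : Matrix (Fin 2) (Fin 2) (ZMod 3)) (h : M 1 0 = 0)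
    (hd : M.det = 1) : M.trace ≠ 0 := by
  obtain ⟨a, b, c, d, rfl⟩ := exists_eq_fin_two_zmod3 M
  rw [Matrix.det_fin_two_of] at hd
  rw [Matrix.trace_fin_two_of]
  simp only [Matrix.of_apply, Matrix.cons_val', Matrix.cons_val_zero, Matrix.cons_val_one,
    Matrix.cons_val_fin_one, Matrix.empty_val'] at h
  subst h
  revert a b d hd; decide

/-- **`C_s⁺(3) = ⟨diag(1,2), antidiag(1,1)⟩` consists of monomial matrices** (diagonal or
antidiagonal; in fact it is the whole monomial subgroup of `GL₂(𝔽₃)`, of order 8). [folklore] -/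
theorem mem_monomial_of_mem_Cs3 {g : GL (Fin 2) (ZMod 3)}
    (hg : g ∈ Subgroup.closure ({(⟨!![1, 0; 0, 2], !![1, 0; 0, 2], by decide, by decide⟩ : GL (Fin 2) (ZMod 3)),
      (⟨!![0, 1; 1, 0], !![0, 1; 1, 0], by decide, by decide⟩ : GL (Fin 2) (ZMod 3))} : Set (GL (Fin 2) (ZMod 3)))) :
    ((g : Matrix (Fin 2) (Fin 2) (ZMod 3)) 0 1 = 0 ∧ (g : Matrix (Fin 2) (Fin 2) (ZMod 3)) 1 0 = 0) ∨
      ((g : Matrix (Fin 2) (Fin 2) (ZMod 3)) 0 0 = 0 ∧ (g : Matrix (Fin 2) (Fin 2) (ZMod 3)) 1 1 = 0) := by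
  -- the monomial elements of `GL₂(𝔽₃)` form a subgroup (closed under products; `u⁻¹ = u³`)
  have hmul : ∀ u v : GL (Fin 2) (ZMod 3),
      (((u : Matrix (Fin 2) (Fin 2) (ZMod 3)) 0 1 = 0 ∧ (u : Matrix (Fin 2) (Fin 2) (ZMod 3)) 1 0 = 0) ∨
        ((u : Matrix (Fin 2) (Fin 2) (ZMod 3)) 0 0 = 0 ∧ (u : Matrix (Fin 2) (Fin 2) (ZMod 3)) 1 1 = 0)) →
      (((v : Matrix (Fin 2) (Fin 2) (ZMod 3)) 0 1 = 0 ∧ (v : Matrix (Fin 2) (Fin 2) (ZMod 3)) 1 0 = 0) ∨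
        ((v : Matrix (Fin 2) (Fin 2) (ZMod 3)) 0 0 = 0 ∧ (v : Matrix (Fin 2) (Fin 2) (ZMod 3)) 1 1 = 0)) →
      ((((u * v : GL (Fin 2) (ZMod 3)) : Matrix (Fin 2) (Fin 2) (ZMod 3)) 0 1 = 0 ∧
          ((u * v : GL (Fin 2) (ZMod 3)) : Matrix (Fin 2) (Fin 2) (ZMod 3)) 1 0 = 0) ∨
        (((u * v : GL (Fin 2) (ZMod 3)) : Matrix (Fin 2) (Fin 2) (ZMod 3)) 0 0 = 0 ∧
          ((u * v : GL (Fin 2) (ZMod 3)) : Matrix (Fin 2) (Fin 2) (ZMod 3)) 1 1 = 0)) := by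
    intro u v hu hv
    obtain ⟨p, q, r, s, hu'⟩ := exists_eq_fin_two_zmod3 (u : Matrix (Fin 2) (Fin 2) (ZMod 3))
    obtain ⟨p', q', r', s', hv'⟩ := exists_eq_fin_two_zmod3 (v : Matrix (Fin 2) (Fin 2) (ZMod 3))
    rw [Units.val_mul, hu', hv', Matrix.mul_fin_two]
    rw [hu'] at hu
    rw [hv'] at hv
    simp only [Matrix.of_apply, Matrix.cons_val', Matrix.cons_val_zero, Matrix.cons_val_one,
      Matrix.cons_val_fin_one, Matrix.empty_val'] at hu hv ⊢
    rcases hu with ⟨rfl, rfl⟩ | ⟨rfl, rfl⟩ <;> rcases hv with ⟨rfl, rfl⟩ | ⟨rfl, rfl⟩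
    · left; constructor <;> ring
    · right; constructor <;> ring
    · right; constructor <;> ring
    · left; constructor <;> ring
  have hinv : ∀ u : GL (Fin 2) (ZMod 3),
      (((u : Matrix (Fin 2) (Fin 2) (ZMod 3)) 0 1 = 0 ∧ (u : Matrix (Fin 2) (Fin 2) (ZMod 3)) 1 0 = 0) ∨
        ((u : Matrix (Fin 2) (Fin 2) (ZMod 3)) 0 0 = 0 ∧ (u : Matrix (Fin 2) (Fin 2) (ZMod 3)) 1 1 = 0)) →
      u⁻¹ = u * u * u := by
    intro u hu
    refine inv_eq_of_mul_eq_one_right (Units.ext ?_)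
    have hdet : IsUnit (Matrix.det (u : Matrix (Fin 2) (Fin 2) (ZMod 3))) := by
      rw [← Matrix.isUnit_iff_isUnit_det]; exact Units.isUnit u
    obtain ⟨p, q, r, s, hu'⟩ := exists_eq_fin_two_zmod3 (u : Matrix (Fin 2) (Fin 2) (ZMod 3))
    rw [hu', Matrix.det_fin_two_of] at hdet
    rw [hu'] at hu
    simp only [Matrix.of_apply, Matrix.cons_val', Matrix.cons_val_zero, Matrix.cons_val_one,
      Matrix.cons_val_fin_one, Matrix.empty_val'] at hu
    rw [Units.val_mul, Units.val_mul, Units.val_mul, Units.val_one, hu', Matrix.mul_fin_two,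
      Matrix.mul_fin_two, Matrix.mul_fin_two, Matrix.one_fin_two]
    clear hu'
    have hne : p * s - q * r ≠ 0 := hdet.ne_zero
    clear hdet
    rcases hu with ⟨rfl, rfl⟩ | ⟨rfl, rfl⟩
    · revert p s hne; decide
    · revert q r hne; decide
  let K : Subgroup (GL (Fin 2) (ZMod 3)) :=
    { carrier := {u | ((u : Matrix (Fin 2) (Fin 2) (ZMod 3)) 0 1 = 0 ∧ (u : Matrix (Fin 2) (Fin 2) (ZMod 3)) 1 0 = 0) ∨
        ((u : Matrix (Fin 2) (Fin 2) (ZMod 3)) 0 0 = 0 ∧ (u : Matrix (Fin 2) (Fin 2) (ZMod 3)) 1 1 = 0)}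
      mul_mem' := fun {u} {v} hu hv => hmul u v hu hv
      one_mem' := Or.inl ⟨by simp, by simp⟩
      inv_mem' := fun {u} hu => by
        rw [Set.mem_setOf_eq] at hu ⊢
        rw [hinv u hu]
        exact hmul _ _ (hmul _ _ hu hu) hu }
  have hle : Subgroup.closure ({(⟨!![1, 0; 0, 2], !![1, 0; 0, 2], by decide, by decide⟩ : GL (Fin 2) (ZMod 3)),
      (⟨!![0, 1; 1, 0], !![0, 1; 1, 0], by decide, by decide⟩ : GL (Fin 2) (ZMod 3))} : Set (GL (Fin 2) (ZMod 3))) ≤ K := by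
    rw [Subgroup.closure_le]
    rintro x hx
    simp only [Set.mem_insert_iff, Set.mem_singleton_iff] at hx
    rcases hx with rfl | rfl
    · exact Or.inl ⟨rfl, rfl⟩
    · exact Or.inr ⟨rfl, rfl⟩
  exact hle hg

/-- **`C_s⁺(3)`, determinant `2` ⇒ trace `0`** (diagonal: `diag(1,2)`, `diag(2,1)`; antidiagonal:
always). [folklore] -/
theorem trace_eq_zero_of_mem_Cs3 {g : GL (Fin 2) (ZMod 3)}
    (hg : g ∈ Subgroup.closure ({(⟨!![1, 0; 0, 2], !![1, 0; 0, 2], by decide, by decide⟩ : GL (Fin 2) (ZMod 3)),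
      (⟨!![0, 1; 1, 0], !![0, 1; 1, 0], by decide, by decide⟩ : GL (Fin 2) (ZMod 3))} : Set (GL (Fin 2) (ZMod 3))))
    (hd : Matrix.det (g : Matrix (Fin 2) (Fin 2) (ZMod 3)) = 2) :
    Matrix.trace (g : Matrix (Fin 2) (Fin 2) (ZMod 3)) = 0 := by
  have hm := mem_monomial_of_mem_Cs3 hg
  obtain ⟨p, q, r, s, hg'⟩ := exists_eq_fin_two_zmod3 (g : Matrix (Fin 2) (Fin 2) (ZMod 3))
  rw [hg'] at hm hd ⊢
  rw [Matrix.det_fin_two_of] at hd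
  rw [Matrix.trace_fin_two_of]
  simp only [Matrix.of_apply, Matrix.cons_val', Matrix.cons_val_zero, Matrix.cons_val_one,
    Matrix.cons_val_fin_one, Matrix.empty_val'] at hm
  clear hg' hg
  rcases hm with ⟨rfl, rfl⟩ | ⟨rfl, rfl⟩
  · revert p s hd; decide
  · revert q r hd; decide

/-- **Determinant `2` ⇒ trace `0` under the whole 3-clause.** If, in some framing, `G ≤ GL₂(𝔽₃)`
is Borel or lies in `C_s⁺(3)` (the route's 3-clause, in conjugation form), then every `g ∈ G` of
determinant `2` has trace `0`. [folklore] -/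
theorem trace_eq_zero_of_borel_or_conj_Cs3 {G : Subgroup (GL (Fin 2) (ZMod 3))}
    (h : ∃ x : GL (Fin 2) (ZMod 3),
      (∀ g ∈ G, ((x * g * x⁻¹ : GL (Fin 2) (ZMod 3)) : Matrix (Fin 2) (Fin 2) (ZMod 3)) 1 0 = 0) ∨
      (∀ g ∈ G, x * g * x⁻¹ ∈ Subgroup.closure ({(⟨!![1, 0; 0, 2], !![1, 0; 0, 2], by decide, by decide⟩ : GL (Fin 2) (ZMod 3)),
        (⟨!![0, 1; 1, 0], !![0, 1; 1, 0], by decide, by decide⟩ : GL (Fin 2) (ZMod 3))} : Set (GL (Fin 2) (ZMod 3))))) :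
    ∀ g ∈ G, Matrix.det (g : Matrix (Fin 2) (Fin 2) (ZMod 3)) = 2 →
      Matrix.trace (g : Matrix (Fin 2) (Fin 2) (ZMod 3)) = 0 := by
  intro g hg hd
  obtain ⟨x, hx⟩ := h
  have hd' : Matrix.det ((x * g * x⁻¹ : GL (Fin 2) (ZMod 3)) : Matrix (Fin 2) (Fin 2) (ZMod 3)) = 2 := by
    rw [Units.val_mul, Units.val_mul, Matrix.det_units_conj]; exact hd
  have key : Matrix.trace ((x * g * x⁻¹ : GL (Fin 2) (ZMod 3)) : Matrix (Fin 2) (Fin 2) (ZMod 3)) = 0 := by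
    rcases hx with hx | hx
    · exact trace_eq_zero_of_borel3 _ (hx g hg) hd'
    · exact trace_eq_zero_of_mem_Cs3 (hx g hg) hd'
  rwa [Units.val_mul, Units.val_mul, Matrix.trace_units_conj] at key

/-- **The one-element kill-lemma at 3 ("large at 3").** A subgroup `G ≤ GL₂(𝔽₃)` containing an
element of determinant `2` and non-zero trace is, in NO framing, Borel or inside `C_s⁺(3)`: the
route's 3-clause fails for `G`.  (For `ρ̄_{E,3}`: one good prime with `N𝔓 ≡ 2 (mod 3)` and
`a_𝔓(E) ≢ 0 (mod 3)`.) [folklore] -/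
theorem not_borel_or_conj_Cs3_of_witness {G : Subgroup (GL (Fin 2) (ZMod 3))} {g : GL (Fin 2) (ZMod 3)}
    (hg : g ∈ G) (hd : Matrix.det (g : Matrix (Fin 2) (Fin 2) (ZMod 3)) = 2)
    (ht : Matrix.trace (g : Matrix (Fin 2) (Fin 2) (ZMod 3)) ≠ 0) :
    ¬ ∃ x : GL (Fin 2) (ZMod 3),
      (∀ g ∈ G, ((x * g * x⁻¹ : GL (Fin 2) (ZMod 3)) : Matrix (Fin 2) (Fin 2) (ZMod 3)) 1 0 = 0) ∨
      (∀ g ∈ G, x * g * x⁻¹ ∈ Subgroup.closure ({(⟨!![1, 0; 0, 2], !![1, 0; 0, 2], by decide, by decide⟩ : GL (Fin 2) (ZMod 3)),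
        (⟨!![0, 1; 1, 0], !![0, 1; 1, 0], by decide, by decide⟩ : GL (Fin 2) (ZMod 3))} : Set (GL (Fin 2) (ZMod 3)))) :=
  fun h => ht (trace_eq_zero_of_borel_or_conj_Cs3 h g hg hd)

/-- **Kill-lemma against Borel at 3, determinant `1`.** A subgroup containing an element of
determinant `1` and trace `0` is not conjugate into the Borel of `GL₂(𝔽₃)` (for `ρ̄_{E,3}`:
`N𝔓 ≡ 1 (mod 3)`, `a_𝔓 ≡ 0 (mod 3)`).  (`C_s⁺(3)` is not excluded by such an element:
`antidiag(1,2) ∈ C_s⁺(3)` has determinant `1` and trace `0`.) [folklore] -/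
theorem not_conj_borel3_of_witness_det_one {G : Subgroup (GL (Fin 2) (ZMod 3))} {g : GL (Fin 2) (ZMod 3)}
    (hg : g ∈ G) (hd : Matrix.det (g : Matrix (Fin 2) (Fin 2) (ZMod 3)) = 1)
    (ht : Matrix.trace (g : Matrix (Fin 2) (Fin 2) (ZMod 3)) = 0) :
    ¬ ∃ x : GL (Fin 2) (ZMod 3),
      ∀ g ∈ G, ((x * g * x⁻¹ : GL (Fin 2) (ZMod 3)) : Matrix (Fin 2) (Fin 2) (ZMod 3)) 1 0 = 0 := by
  rintro ⟨x, hx⟩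
  have hd' : Matrix.det ((x * g * x⁻¹ : GL (Fin 2) (ZMod 3)) : Matrix (Fin 2) (Fin 2) (ZMod 3)) = 1 := by
    rw [Units.val_mul, Units.val_mul, Matrix.det_units_conj]; exact hd
  refine trace_ne_zero_of_borel3 _ (hx g hg) hd' ?_
  rw [Units.val_mul, Units.val_mul, Matrix.trace_units_conj]; exact ht

/-! ## 3. The discriminant form at `3` (the cell's flags `W3b`, `W3s`) -/

/-- **`C_s⁺(3)`, non-zero trace ⇒ square discriminant.**  A monomial element of `GL₂(𝔽₃)` with
non-zero trace is diagonal, so its `trace² − 4 det = (a − d)²` is a square. [folklore] -/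
theorem isSquare_disc_of_mem_Cs3 {g : GL (Fin 2) (ZMod 3)}
    (hg : g ∈ Subgroup.closure ({(⟨!![1, 0; 0, 2], !![1, 0; 0, 2], by decide, by decide⟩ : GL (Fin 2) (ZMod 3)),
      (⟨!![0, 1; 1, 0], !![0, 1; 1, 0], by decide, by decide⟩ : GL (Fin 2) (ZMod 3))} : Set (GL (Fin 2) (ZMod 3))))
    (ht : Matrix.trace (g : Matrix (Fin 2) (Fin 2) (ZMod 3)) ≠ 0) :
    IsSquare (Matrix.trace (g : Matrix (Fin 2) (Fin 2) (ZMod 3)) ^ 2 -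
      4 * Matrix.det (g : Matrix (Fin 2) (Fin 2) (ZMod 3))) := by
  rcases mem_monomial_of_mem_Cs3 hg with ⟨-, h10⟩ | ⟨h00, h11⟩
  · exact ⟨_, by rw [trace_sq_sub_four_det_of_apply_one_zero _ h10, sq]⟩
  · exfalso; apply ht
    rw [Matrix.trace_fin_two, h00, h11, add_zero]

/-- **Kill-lemma against `C_s⁺(3)`, discriminant form** (the cell's flag `W3s`): a subgroup
containing an element with non-zero trace and NON-SQUARE `trace² − 4 det` is not conjugate into
`C_s⁺(3)`.  (Over `𝔽₃` this is the same witness as `det = 2`, `trace ≠ 0`.) [folklore] -/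
theorem not_conj_Cs3_of_witness_disc {G : Subgroup (GL (Fin 2) (ZMod 3))} {g : GL (Fin 2) (ZMod 3)}
    (hg : g ∈ G) (ht : Matrix.trace (g : Matrix (Fin 2) (Fin 2) (ZMod 3)) ≠ 0)
    (hns : ¬ IsSquare (Matrix.trace (g : Matrix (Fin 2) (Fin 2) (ZMod 3)) ^ 2 -
      4 * Matrix.det (g : Matrix (Fin 2) (Fin 2) (ZMod 3)))) :
    ¬ ∃ x : GL (Fin 2) (ZMod 3), ∀ g ∈ G, x * g * x⁻¹ ∈
      Subgroup.closure ({(⟨!![1, 0; 0, 2], !![1, 0; 0, 2], by decide, by decide⟩ : GL (Fin 2) (ZMod 3)),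
        (⟨!![0, 1; 1, 0], !![0, 1; 1, 0], by decide, by decide⟩ : GL (Fin 2) (ZMod 3))} : Set (GL (Fin 2) (ZMod 3))) := by
  rintro ⟨x, hx⟩
  apply hns
  have key := isSquare_disc_of_mem_Cs3 (hx g hg)
  rw [Units.val_mul, Units.val_mul, Matrix.trace_units_conj, Matrix.det_units_conj] at key
  exact key ht

/-- **"Large at 3" from one element, discriminant form** (flags `W3b` + `W3s` on the same prime):
`g ∈ G` with non-zero trace and non-square `trace² − 4 det` excludes, in every framing, both Borel
and `C_s⁺(3)` — the route's 3-clause fails for `G`. [folklore] -/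
theorem not_borel_or_conj_Cs3_of_witness_disc {G : Subgroup (GL (Fin 2) (ZMod 3))} {g : GL (Fin 2) (ZMod 3)}
    (hg : g ∈ G) (ht : Matrix.trace (g : Matrix (Fin 2) (Fin 2) (ZMod 3)) ≠ 0)
    (hns : ¬ IsSquare (Matrix.trace (g : Matrix (Fin 2) (Fin 2) (ZMod 3)) ^ 2 -
      4 * Matrix.det (g : Matrix (Fin 2) (Fin 2) (ZMod 3)))) :
    ¬ ∃ x : GL (Fin 2) (ZMod 3),
      (∀ g ∈ G, ((x * g * x⁻¹ : GL (Fin 2) (ZMod 3)) : Matrix (Fin 2) (Fin 2) (ZMod 3)) 1 0 = 0) ∨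
      (∀ g ∈ G, x * g * x⁻¹ ∈ Subgroup.closure ({(⟨!![1, 0; 0, 2], !![1, 0; 0, 2], by decide, by decide⟩ : GL (Fin 2) (ZMod 3)),
        (⟨!![0, 1; 1, 0], !![0, 1; 1, 0], by decide, by decide⟩ : GL (Fin 2) (ZMod 3))} : Set (GL (Fin 2) (ZMod 3)))) := by
  rintro ⟨x, hx | hx⟩
  · exact not_conj_borel_of_witness hg hns ⟨x, hx⟩
  · exact not_conj_Cs3_of_witness_disc hg ht hns ⟨x, hx⟩

end Summit.Langlands.Langlands.Theorems.SqrtFiveQuarticCovers
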